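import Literature.NumberTheory.ComplexMultiplication.CMOrderTraceDualInverseDifferent
import Literature.NumberTheory.ComplexMultiplication.CMOrderFiniteIndexSubrings
import HarnessLib

/-!
# The conductor–different formula `𝔣 · 𝔇_{K/ℚ} = (f′(α))` for the monogenic orders `ℤ[α]` of the series, and its
# order-series form `𝔣 = f′(α) · 𝓞_Kᵗ`

Layer A3 of the Hodge/CM programme (docs/m5/MAPPING.md §1), junction of the "arbitrary order" series with Mathlib.
For a MONOGENIC order `𝔯 = endOrder ρ = ℤ[α]` (`α ∈ 𝓞_K`, `ℚ(α) = K`, `f` the minimal polynomial of `α`):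

* §1 **`conductor_mul_differentIdeal_eq_span_aeval_derivative`** — the series' conductor `𝔣 = {a ∈ 𝓞_K : a𝓞_K ⊆ 𝔯}`
  (`CMOrderConductor`; `= conductor ℤ α`, `CMOrderFiniteIndexSubrings`) and Mathlib's different satisfy
  `𝔣 · 𝔇_{K/ℚ} = (f′(α))` (Dedekind; Mathlib `conductor_mul_differentIdeal`); `aeval_derivative_mem_conductor`: `f′(α) ∈ 𝔣`.
* §2 the same INSIDE `ICM(𝔯)` (`𝔯 = endOrder (M_μ) = ℤ[π]`, `M = MM ≠ 0` with `↑M = 𝓞_K`, `↑T = Mᵗ = 𝓞_Kᵗ`):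
  `coe_conductorIdeal_eq_one_div` (`𝔣 = (𝔯 : 𝓞_K)` as a fractional `𝔯`-ideal),
  **`one_div_eq_spanSingleton_mul_traceDual_of_monogenic`** — `(𝔯 : 𝓞_K) = f′(π) · 𝓞_Kᵗ`, from EULER'S LEMMA
  `𝔯ᵗ = f′(π)⁻¹𝔯` (`CMOrderGorenstein.eq_spanSingleton_inv_mul_of_monogenic`, [BuchmannLenstra1994, Ex. 2.8];
  [NeukirchANT1999, III (2.4) and the remark after its proof: «`*𝒪[α] = f′(α)⁻¹𝒪[α]`»]) and the duality
  `(I:J) = (Jᵗ:Iᵗ)` (`div_eq_div_of_coe_eq_traceDual`); extended to `𝓞_K`: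
  **`coeIdeal_conductor_eq_spanSingleton_mul_dual_one`** (`𝔣 = f′(π) · 𝔆_{𝓞_K|ℤ}`) and
  `coeIdeal_conductor_mul_coeIdeal_differentIdeal_eq_spanSingleton` (`𝔣 · 𝔇 = (f′(π))`, recovered through the series).

Theorems only (no new definitions, no named facts).

## References
* [NeukirchANT1999] J. Neukirch, *Algebraic Number Theory*, Springer 1999 — Ch. III §2 Def. (2.1) p. 195, Prop. (2.4)
  and the remark after its proof («the module `*𝒪[α]` … always equals `f′(α)⁻¹𝒪[α]`»), pp. 197–198.
* [BuchmannLenstra1994] J. A. Buchmann, H. W. Lenstra Jr., *Approximating rings of integers in number fields*,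
  JTNB 6 (1994) — §2 Prop. 2.4 («`(A:b)† …`»), Example 2.8 («`A† = f′(α)⁻¹A`»), pp. 229–231.
* [Stevenhagen2008NumberRings] P. Stevenhagen, *The arithmetic of number rings*, MSRI Publ. 44 — §6 (the conductor), p. 224.
-/

noncomputable section

open scoped Classical nonZeroDivisors NumberField Pointwise
open NumberField Module FractionalIdeal Polynomial

namespace Literature.NumberTheory.ComplexMultiplication

/-! ## §1 `𝔣 · 𝔇 = (f′(α))` for `𝔯 = ℤ[α]`, through Mathlib -/

section Mathlib

variable {K : Type} [Field K] [NumberField K]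
variable {ι : Type} [Fintype ι] [DecidableEq ι] [Nonempty ι] {ρ : K →ₐ[ℚ] Matrix ι ι ℚ}

/-- **DEDEKIND'S CONDUCTOR–DIFFERENT FORMULA for a monogenic order of the series: `𝔯 = ℤ[α]` ⟹
`𝔣_𝔯 · 𝔇_{K/ℚ} = (f′(α))`** (`𝔣_𝔯` the conductor of `CMOrderConductor`, `𝔇` Mathlib's `differentIdeal ℤ (𝓞 K)`, `f` the
minimal polynomial of `α` over `ℤ`). [cite: NeukirchANT1999, Ch. III §2 Prop. (2.4) and the remark after its proof,
pp. 197–198] [cite: BuchmannLenstra1994, §2 Example 2.8, p. 231] -/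
theorem EndOrder.conductor_mul_differentIdeal_eq_span_aeval_derivative {x : 𝓞 K}
    (h : endOrder ρ = (Algebra.adjoin ℤ ({(x : K)} : Set K)).toSubring) (hx : Algebra.adjoin ℚ ({(x : K)} : Set K) = ⊤) :
    EndOrder.conductor ρ * differentIdeal ℤ (𝓞 K) = Ideal.span {aeval x (derivative (minpoly ℤ x))} := by
  rw [EndOrder.conductor_eq_conductor_of_endOrder_eq_adjoin h]
  exact conductor_mul_differentIdeal ℤ ℚ K x hx

/-- **`f′(α) ∈ 𝔣_𝔯`** for `𝔯 = ℤ[α]` (`𝔣 ⊇ 𝔣·𝔇 = (f′(α))`). [cite: NeukirchANT1999, Ch. III §2 (remark after (2.4)), p. 198]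
[cite: Stevenhagen2008NumberRings, §6, p. 224] -/
theorem EndOrder.aeval_derivative_mem_conductor {x : 𝓞 K}
    (h : endOrder ρ = (Algebra.adjoin ℤ ({(x : K)} : Set K)).toSubring) (hx : Algebra.adjoin ℚ ({(x : K)} : Set K) = ⊤) :
    aeval x (derivative (minpoly ℤ x)) ∈ EndOrder.conductor ρ := by
  refine SetLike.le_def.mp (Ideal.mul_le_right (J := differentIdeal ℤ (𝓞 K))) ?_
  rw [EndOrder.conductor_mul_differentIdeal_eq_span_aeval_derivative h hx]
  exact Ideal.mem_span_singleton_self _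

end Mathlib

/-! ## §2 Inside `ICM(𝔯)`: `𝔣 = (𝔯 : 𝓞_K) = f′(π) · 𝓞_Kᵗ` -/

namespace CMTypeLattice

section Series

variable {K : Type} [Field K] [NumberField K]
variable {ι : Type} [Fintype ι] [DecidableEq ι] [Nonempty ι] (μ : Basis ι ℚ K)
variable [IsFractionRing (endOrder (Algebra.leftMulMatrix μ)) K]

/-- **The conductor as a fractional `𝔯`-ideal is `(𝔯 : 𝓞_K)`**: `↑𝔣 = 1/M` for the idempotent `M` with `↑M = 𝓞_K`
(`𝔣 = {a : a𝓞_K ⊆ 𝔯}`). [cite: Stevenhagen2008NumberRings, §6 («the largest `𝒪`-ideal contained in `R`»), p. 224]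
[cite: Marseglia2019, §5 («`𝔣 = (S:T)` … the biggest fractional `T`-ideal in `S`»), p. 10] -/
theorem coe_conductorIdeal_eq_one_div {M : FractionalIdeal (endOrder (Algebra.leftMulMatrix μ))⁰ K} (hM0 : M ≠ 0)
    (hMO : (M : Set K) = (algebraMap (𝓞 K) K).range) :
    ((EndOrder.conductorIdeal (Algebra.leftMulMatrix μ) : Ideal (endOrder (Algebra.leftMulMatrix μ))) :
      FractionalIdeal (endOrder (Algebra.leftMulMatrix μ))⁰ K) = 1 / M := by
  have hmem : ∀ m : K, m ∈ M ↔ ∃ y : 𝓞 K, (y : K) = m := fun m => by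
    rw [← SetLike.mem_coe, hMO]
    exact ⟨fun ⟨y, hy⟩ => ⟨y, hy⟩, fun ⟨y, hy⟩ => ⟨y, hy⟩⟩
  ext x
  rw [mem_coeIdeal, mem_div_iff_of_ne_zero hM0]
  constructor
  · rintro ⟨r, hr, rfl⟩ m hm
    obtain ⟨y, rfl⟩ := (hmem m).1 hm
    exact (mem_one_iff _).2 ⟨⟨_, (EndOrder.mem_conductorIdeal_iff _).1 hr y⟩, rfl⟩
  · intro hx
    have hx1 : x ∈ endOrder (Algebra.leftMulMatrix μ) := by
      have h := hx 1 ((hmem 1).2 ⟨1, by simp⟩)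
      rw [mul_one] at h
      obtain ⟨r, hr⟩ := (mem_one_iff _).1 h
      rw [← hr]
      exact r.2
    refine ⟨⟨x, hx1⟩, (EndOrder.mem_conductorIdeal_iff _).2 fun y => ?_, rfl⟩
    obtain ⟨r, hr⟩ := (mem_one_iff _).1 (hx y ((hmem y).2 ⟨y, rfl⟩))
    rw [← hr]
    exact r.2

omit [Nonempty ι] in
/-- **`(𝔯 : 𝓞_K) = f′(π) · 𝓞_Kᵗ` for the monogenic order `𝔯 = ℤ[π]`** — from EULER'S LEMMA `𝔯ᵗ = f′(π)⁻¹𝔯` and the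
duality `(𝔯 : 𝓞_K) = (𝓞_Kᵗ : 𝔯ᵗ)` (`M = MM ≠ 0` with `↑M = 𝓞_K`, `↑T = Mᵗ`, `↑T₁ = 𝔯ᵗ`).
[cite: NeukirchANT1999, Ch. III §2 Prop. (2.4) and remark («`*𝒪[α] = f′(α)⁻¹𝒪[α]`»), pp. 197–198]
[cite: BuchmannLenstra1994, §2 Prop. 2.4 (proof: «`(b:a)† = …`») and Example 2.8, pp. 229–231] -/
theorem one_div_eq_spanSingleton_mul_traceDual_of_monogenic
    {M T T₁ : FractionalIdeal (endOrder (Algebra.leftMulMatrix μ))⁰ K} (hM0 : M ≠ 0)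
    (hT : (T : Submodule (endOrder (Algebra.leftMulMatrix μ)) K) =
      Submodule.traceDual ℤ ℚ (M : Submodule (endOrder (Algebra.leftMulMatrix μ)) K))
    (hT₁ : (T₁ : Submodule (endOrder (Algebra.leftMulMatrix μ)) K) =
      Submodule.traceDual ℤ ℚ ((1 : FractionalIdeal (endOrder (Algebra.leftMulMatrix μ))⁰ K) :
        Submodule (endOrder (Algebra.leftMulMatrix μ)) K))
    {π : K} (hπ : Algebra.adjoin ℚ {π} = ⊤) (hint : IsIntegral ℤ π)
    (h𝔯π : ((1 : FractionalIdeal (endOrder (Algebra.leftMulMatrix μ))⁰ K) :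
      Submodule (endOrder (Algebra.leftMulMatrix μ)) K).restrictScalars ℤ = Subalgebra.toSubmodule (Algebra.adjoin ℤ {π})) :
    (1 : FractionalIdeal (endOrder (Algebra.leftMulMatrix μ))⁰ K) / M =
      spanSingleton (endOrder (Algebra.leftMulMatrix μ))⁰ (aeval π (derivative (minpoly ℚ π))) * T := by
  have h10 : (1 : FractionalIdeal (endOrder (Algebra.leftMulMatrix μ))⁰ K) ≠ 0 :=
    one_ne_zero' (FractionalIdeal (endOrder (Algebra.leftMulMatrix μ))⁰ K)
  have hT₁0 : T₁ ≠ 0 := by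
    obtain ⟨T', hT'0, hT'⟩ := exists_coe_eq_traceDual μ h10
    rwa [← coeToSubmodule_inj.1 (hT'.trans hT₁.symm)]
  rw [div_eq_div_of_coe_eq_traceDual μ h10 hM0 hT₁0 hT₁ hT,
    eq_spanSingleton_inv_mul_of_monogenic μ hπ hint h𝔯π hT₁, mul_one, div_spanSingleton, inv_inv]

/-- **`𝔣 = f′(π) · 𝓞_Kᵗ` inside `ICM(𝔯)`** for `𝔯 = ℤ[π]`: the conductor, as a fractional `𝔯`-ideal, is `f′(π)` times
the trace dual of the maximal order. [cite: NeukirchANT1999, Ch. III §2 (2.4) and remark, pp. 197–198]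
[cite: BuchmannLenstra1994, §2 Example 2.8, p. 231] -/
theorem coe_conductorIdeal_eq_spanSingleton_mul_traceDual_of_monogenic
    {M T T₁ : FractionalIdeal (endOrder (Algebra.leftMulMatrix μ))⁰ K} (hM0 : M ≠ 0)
    (hMO : (M : Set K) = (algebraMap (𝓞 K) K).range)
    (hT : (T : Submodule (endOrder (Algebra.leftMulMatrix μ)) K) =
      Submodule.traceDual ℤ ℚ (M : Submodule (endOrder (Algebra.leftMulMatrix μ)) K))
    (hT₁ : (T₁ : Submodule (endOrder (Algebra.leftMulMatrix μ)) K) =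
      Submodule.traceDual ℤ ℚ ((1 : FractionalIdeal (endOrder (Algebra.leftMulMatrix μ))⁰ K) :
        Submodule (endOrder (Algebra.leftMulMatrix μ)) K))
    {π : K} (hπ : Algebra.adjoin ℚ {π} = ⊤) (hint : IsIntegral ℤ π)
    (h𝔯π : ((1 : FractionalIdeal (endOrder (Algebra.leftMulMatrix μ))⁰ K) :
      Submodule (endOrder (Algebra.leftMulMatrix μ)) K).restrictScalars ℤ = Subalgebra.toSubmodule (Algebra.adjoin ℤ {π})) :
    ((EndOrder.conductorIdeal (Algebra.leftMulMatrix μ) : Ideal (endOrder (Algebra.leftMulMatrix μ))) :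
      FractionalIdeal (endOrder (Algebra.leftMulMatrix μ))⁰ K) =
      spanSingleton (endOrder (Algebra.leftMulMatrix μ))⁰ (aeval π (derivative (minpoly ℚ π))) * T := by
  rw [coe_conductorIdeal_eq_one_div μ hM0 hMO,
    one_div_eq_spanSingleton_mul_traceDual_of_monogenic μ hM0 hT hT₁ hπ hint h𝔯π]

/-- **`𝔣 = f′(π) · 𝔆_{𝓞_K|ℤ}` in Mathlib's fractional `𝓞_K`-ideals** (extend along `N ↦ N𝓞_K`: `𝔣𝓞_K = 𝔣`,
`𝓞_Kᵗ ↦ FractionalIdeal.dual ℤ ℚ 1`, `CMOrderTraceDualInverseDifferent`). [cite: NeukirchANT1999, Ch. III §2 Def. (2.1),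
Prop. (2.4) and remark, pp. 195–198] -/
theorem coeIdeal_conductor_eq_spanSingleton_mul_dual_one
    {M T T₁ : FractionalIdeal (endOrder (Algebra.leftMulMatrix μ))⁰ K} (hMM : M * M = M) (hM0 : M ≠ 0)
    (hMO : (M : Set K) = (algebraMap (𝓞 K) K).range)
    (hT : (T : Submodule (endOrder (Algebra.leftMulMatrix μ)) K) =
      Submodule.traceDual ℤ ℚ (M : Submodule (endOrder (Algebra.leftMulMatrix μ)) K))
    (hT₁ : (T₁ : Submodule (endOrder (Algebra.leftMulMatrix μ)) K) =
      Submodule.traceDual ℤ ℚ ((1 : FractionalIdeal (endOrder (Algebra.leftMulMatrix μ))⁰ K) :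
        Submodule (endOrder (Algebra.leftMulMatrix μ)) K))
    {π : K} (hπ : Algebra.adjoin ℚ {π} = ⊤) (hint : IsIntegral ℤ π)
    (h𝔯π : ((1 : FractionalIdeal (endOrder (Algebra.leftMulMatrix μ))⁰ K) :
      Submodule (endOrder (Algebra.leftMulMatrix μ)) K).restrictScalars ℤ = Subalgebra.toSubmodule (Algebra.adjoin ℤ {π})) :
    ((EndOrder.conductor (Algebra.leftMulMatrix μ) : Ideal (𝓞 K)) : FractionalIdeal (𝓞 K)⁰ K) =
      spanSingleton (𝓞 K)⁰ (aeval π (derivative (minpoly ℚ π))) * FractionalIdeal.dual ℤ ℚ (1 : FractionalIdeal (𝓞 K)⁰ K) := by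
  rw [← EndOrder.map_conductorIdeal, ← EndOrder.extend_coeIdeal,
    coe_conductorIdeal_eq_spanSingleton_mul_traceDual_of_monogenic μ hM0 hMO hT hT₁ hπ hint h𝔯π, map_mul,
    EndOrder.extend_spanSingleton, extend_eq_dual_one μ hMM hM0 hMO hT]

/-- **`𝔣 · 𝔇_{K/ℚ} = (f′(π))` recovered through the series** (`𝔆 · 𝔇 = 𝓞_K`; the `ℚ`-minimal polynomial of `π`).
[cite: NeukirchANT1999, Ch. III §2 Def. (2.1) and Prop. (2.4), pp. 195–197] -/
theorem coeIdeal_conductor_mul_coeIdeal_differentIdeal_eq_spanSingleton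
    {M T T₁ : FractionalIdeal (endOrder (Algebra.leftMulMatrix μ))⁰ K} (hMM : M * M = M) (hM0 : M ≠ 0)
    (hMO : (M : Set K) = (algebraMap (𝓞 K) K).range)
    (hT : (T : Submodule (endOrder (Algebra.leftMulMatrix μ)) K) =
      Submodule.traceDual ℤ ℚ (M : Submodule (endOrder (Algebra.leftMulMatrix μ)) K))
    (hT₁ : (T₁ : Submodule (endOrder (Algebra.leftMulMatrix μ)) K) =
      Submodule.traceDual ℤ ℚ ((1 : FractionalIdeal (endOrder (Algebra.leftMulMatrix μ))⁰ K) :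
        Submodule (endOrder (Algebra.leftMulMatrix μ)) K))
    {π : K} (hπ : Algebra.adjoin ℚ {π} = ⊤) (hint : IsIntegral ℤ π)
    (h𝔯π : ((1 : FractionalIdeal (endOrder (Algebra.leftMulMatrix μ))⁰ K) :
      Submodule (endOrder (Algebra.leftMulMatrix μ)) K).restrictScalars ℤ = Subalgebra.toSubmodule (Algebra.adjoin ℤ {π})) :
    ((EndOrder.conductor (Algebra.leftMulMatrix μ) : Ideal (𝓞 K)) : FractionalIdeal (𝓞 K)⁰ K) *
        ((differentIdeal ℤ (𝓞 K) : Ideal (𝓞 K)) : FractionalIdeal (𝓞 K)⁰ K) =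
      spanSingleton (𝓞 K)⁰ (aeval π (derivative (minpoly ℚ π))) := by
  rw [coeIdeal_conductor_eq_spanSingleton_mul_dual_one μ hMM hM0 hMO hT hT₁ hπ hint h𝔯π, mul_assoc,
    coeIdeal_differentIdeal (A := ℤ) (K := ℚ) (L := K) (B := 𝓞 K),
    mul_inv_cancel₀ (dual_ne_zero ℤ ℚ (one_ne_zero' (FractionalIdeal (𝓞 K)⁰ K))), mul_one]

end Series

end CMTypeLattice

end Literature.NumberTheory.ComplexMultiplication
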